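import Summits.PneNP.PneNP.Theses.PrimalityPlaces
import Summits.PneNP.PneNP.Theses.ProofCplx
import Summits.PneNP.PneNP.Theorems.ExpanderLinearGeneratorsTautBridge

/-!
# REDIRECT r1 probes for crux `EFPrimalityHard` (stmt-PneNP-16927), route-PneNP-PrimalityPlaces

Part A — BC2 probes in SELF-CERTIFYING form: each `example` ends in `| sorry`, so the file elaborates and the
number of `declaration uses 'sorry'` warnings EQUALS the number of probes whose search tactics all failed
(aesop in terminal mode so that a failed search is an error and `first` moves on).
  P1  C → S      (EFPrimalityHard → PneNP)                      expected FAIL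
  P2  S → C      (PneNP → EFPrimalityHard)                      expected FAIL
  P3  C → X      (EFPrimalityHard → NoPolyBoundedProofSystem)   expected FAIL
  P4  X → C      (NoPolyBoundedProofSystem → EFPrimalityHard)   expected FAIL
  P5  C → EF¬pb  (EFPrimalityHard → ProofCplx.ProofcplxEfNotPbounded)  expected FAIL for the cheap probe
                 (true, but needs the size estimate |σ_p| = O(n²): support item EFPrimalityGivesEFNotPolyBounded)
  P6  (C → X) → S  (EFPrimalityReachesX → PneNP)                expected FAIL (vacuous when C is false)
Part B — the partner crux `EFPrimalityReachesX` IS the thesis X in costume, kernel-checked (no sorry):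
  B1  X → EFPrimalityReachesX;  B2  EFPrimalityHard → (EFPrimalityReachesX ↔ X);
  B3  (EFPrimalityHard ∧ EFPrimalityReachesX) ↔ (EFPrimalityHard ∧ X);  B4  X → PneNP (landed bridge);
  B5  the route's `closes` factors through X: closes h6 h7 hB = hB (h7 h6) and X alone closes.
-/

set_option maxHeartbeats 400000

open Summit.PneNP.PneNP.Theses

namespace RedirectR1

abbrev C : Prop := PrimalityPlaces.EFPrimalityHard
abbrev X : Prop := PrimalityPlaces.NoPolyBoundedProofSystem
abbrev R : Prop := PrimalityPlaces.EFPrimalityReachesX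

/-! ## Part A — cheap probes (each expected to FAIL, i.e. to fall through to `sorry`) -/

-- P1: C → S
example : PrimalityPlaces.EFPrimalityHard → _root_.PneNP := by
  first | exact? | simpa [PrimalityPlaces.EFPrimalityHard] | (unfold PrimalityPlaces.EFPrimalityHard; simpa) | (aesop (config := { terminal := true, warnOnNonterminal := false })) | sorry
-- P2: S → C
example : _root_.PneNP → PrimalityPlaces.EFPrimalityHard := by
  first | exact? | simpa [PrimalityPlaces.EFPrimalityHard] | (unfold PrimalityPlaces.EFPrimalityHard; simpa) | (aesop (config := { terminal := true, warnOnNonterminal := false })) | sorry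
-- P3: C → X
example : PrimalityPlaces.EFPrimalityHard → PrimalityPlaces.NoPolyBoundedProofSystem := by
  first | exact? | simpa [PrimalityPlaces.EFPrimalityHard, PrimalityPlaces.NoPolyBoundedProofSystem] | (unfold PrimalityPlaces.EFPrimalityHard PrimalityPlaces.NoPolyBoundedProofSystem; simpa) | (aesop (config := { terminal := true, warnOnNonterminal := false })) | sorry
-- P4: X → C
example : PrimalityPlaces.NoPolyBoundedProofSystem → PrimalityPlaces.EFPrimalityHard := by
  first | exact? | simpa [PrimalityPlaces.EFPrimalityHard, PrimalityPlaces.NoPolyBoundedProofSystem] | (unfold PrimalityPlaces.EFPrimalityHard PrimalityPlaces.NoPolyBoundedProofSystem; simpa) | (aesop (config := { terminal := true, warnOnNonterminal := false })) | sorry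
-- P5: C → "EF is not polynomially bounded" (ProofCplx #4) — TRUE (support EFPrimalityGivesEFNotPolyBounded) but not cheap
example : PrimalityPlaces.EFPrimalityHard → ProofCplx.ProofcplxEfNotPbounded := by
  first | exact? | simpa [PrimalityPlaces.EFPrimalityHard, ProofCplx.ProofcplxEfNotPbounded] | (aesop (config := { terminal := true, warnOnNonterminal := false })) | sorry
-- P6: (C → X) → S
example : PrimalityPlaces.EFPrimalityReachesX → _root_.PneNP := by
  first | exact? | simpa [PrimalityPlaces.EFPrimalityReachesX] | (unfold PrimalityPlaces.EFPrimalityReachesX; simpa) | (aesop (config := { terminal := true, warnOnNonterminal := false })) | sorry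

/-! ## Part B — where the summit sits in this route (kernel-checked, sorry-free) -/

/-- B1: the thesis X gives the partner crux outright. -/
theorem reachesX_of_X : X → R := fun hX _ => hX

/-- B2: given the deciding crux C, the partner crux is EQUIVALENT to X. -/
theorem reachesX_iff_X (hC : C) : R ↔ X := ⟨fun h7 => h7 hC, fun hX _ => hX⟩

/-- B3: the open cone {C, C → X} of `closes` is the conjunction C ∧ X. -/
theorem cone_iff : (C ∧ R) ↔ (C ∧ X) :=
  ⟨fun ⟨hC, h7⟩ => ⟨hC, h7 hC⟩, fun ⟨hC, hX⟩ => ⟨hC, fun _ => hX⟩⟩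

/-- B4: X alone already closes the summit (landed bridge `tautBridge_proof`, shared decl). -/
theorem summit_of_X : X → _root_.PneNP := _root_.Summit.PneNP.PneNP.Theorems.tautBridge_proof

/-- B4': the route's TautBridge support is the landed theorem (same Prop as ExpanderLinearGenerators.TautBridge). -/
theorem tautBridge_holds : PrimalityPlaces.TautBridge := _root_.Summit.PneNP.PneNP.Theorems.tautBridge_proof

/-- B5: the route's deciding theorem, with the landed bridge supplied, is `X ∘ (h7 h6)`: C enters only as the
argument of h7, i.e. `closes` = (C, C → X) ↦ X ↦ S. -/
theorem closes_via_X (h6 : C) (h7 : R) : _root_.PneNP := summit_of_X (h7 h6)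

example (h6 : C) (h7 : R) : PrimalityPlaces.closes h6 h7 tautBridge_holds = closes_via_X h6 h7 := rfl

/-- B6: conversely R is DEFINITIONALLY `C → X` (so "R without C" carries no information toward S). -/
example : R = (C → X) := rfl

end RedirectR1
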